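/-
Origin: expansion seat `planner-pub-hodgecm-pv04-g6-0`, handover #1 2026-08-18T09:23:06Z (`HOME/pub-hodgecm-pv04-g6/lean/Pv04g6/RestrictMor.lean`, md5 2994f742, 142 lines);
landed by the gen-7 packager in gate run 27 as `HodgeCM/Model/RestrictMor.lean` (verbatim).
-/
/-
Copyright: pub-hodgecm cell (HodgeCMPerL). Consistency-witness layer (part (e)); FACTS.md §1c row (M38), column P5.
Origin: HOME/pub-hodgecm-pv04-g6/lean/Pv04g6/RestrictMor.lean (WIP module `Pv04g6.RestrictMor`; intended final place
`HodgeCM/Model/RestrictMor.lean` = module `HodgeCM.Model.RestrictMor`, CONTRIBUTING §3 kind L5) (seat planner-pub-hodgecm-pv04-g6-0,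
DAG-node prover #04 gen 6, seam S6 / fact row M38).
-/
import Summits.HodgeConjecture.HodgeCM.Geometry.Facts

/-!
# Restricting a universe to a class of morphisms

For a universe `U` and a class `C` of morphisms of `U` that contains the identities and the two product
projections and is closed under composition (`Universe.MorClass`), `U.restrict C` is the universe with the SAME
varieties, cohomology, Hodge structures, algebraic classes, cup product, trace, products, CM abelian varieties,
CM actions and Picard modular surfaces, whose morphisms are the morphisms of `U` lying in `C` (a wide
subcategory), with the restricted pull-back.

`Universe.ModelAxioms.restrict`: the 24 universally quantified fields of `ModelAxioms` (M1–M16, M19–M23,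
M26–M28 in the numbering of `HOME/FACTS.md` §1) transfer to `U.restrict C` outright; the four fields that
assert the EXISTENCE of morphisms — M17 `Fact_cmDominated`, M18 `Fact_lift`, M24 `Fact_cmEnd`,
M25 `Fact_conjIsogeny` — transfer as soon as they are re-proved for the restricted universe (i.e. as soon as the
class `C` contains the relevant witnesses).  Used by `HodgeCM.Toy.CMInflationIndependent` (independence of
M38 `Fact_cmInflation` from `ModelAxioms`).
-/

noncomputable section

namespace HodgeCM

namespace Universe

open Literature.AlgebraicGeometry.Motives

variable (U : Universe)

/-- A class of morphisms of `U` containing the identities and the product projections and closed under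
composition. -/
structure MorClass where
  /-- membership -/
  P : ∀ {X Y : U.Var}, U.Mor X Y → Prop
  id_mem : ∀ X : U.Var, P (U.idMor X)
  comp_mem : ∀ {X Y Z : U.Var} (f : U.Mor X Y) (g : U.Mor Y Z), P f → P g → P (U.comp f g)
  fst_mem : ∀ X Y : U.Var, P (U.fst X Y)
  snd_mem : ∀ X Y : U.Var, P (U.snd X Y)

variable {U}

/-- **The restricted universe**: same data as `U`, morphisms restricted to the class `C` (reducible, so that
its fields compute). -/
@[reducible] def restrict (C : U.MorClass) : Universe :=
  { U with
    Mor := fun X Y => {f : U.Mor X Y // C.P f}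
    idMor := fun X => ⟨U.idMor X, C.id_mem X⟩
    comp := fun f g => ⟨U.comp f.1 g.1, C.comp_mem f.1 g.1 f.2 g.2⟩
    pull := fun f k => U.pull f.1 k
    fst := fun X Y => ⟨U.fst X Y, C.fst_mem X Y⟩
    snd := fun X Y => ⟨U.snd X Y, C.snd_mem X Y⟩ }

variable (C : U.MorClass)

/-- (Ported verbatim from the HodgeCMPerL package; no docstring in the source.) -/
theorem restrict_pull {X Y : U.Var} (f : (U.restrict C).Mor X Y) (k : ℕ) :
    (U.restrict C).pull f k = U.pull f.1 k := rfl

/-- (Ported verbatim from the HodgeCMPerL package; no docstring in the source.) -/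
theorem restrict_pullC {X Y : U.Var} (f : (U.restrict C).Mor X Y) (k : ℕ) :
    (U.restrict C).pullC f k = U.pullC f.1 k := rfl

/-- The four projections of the corner product are the old ones. -/
theorem restrict_pr4_val (K : CMField) (Φ : Fin 4 → CMType K) (i : Fin 4) :
    ((U.restrict C).pr4 K Φ i).1 = U.pr4 K Φ i := by
  fin_cases i <;> rfl

/-- (Ported verbatim from the HodgeCMPerL package; no docstring in the source.) -/
theorem restrict_pull_pr4 (K : CMField) (Φ : Fin 4 → CMType K) (i : Fin 4) (k : ℕ) :
    (U.restrict C).pull ((U.restrict C).pr4 K Φ i) k = U.pull (U.pr4 K Φ i) k := by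
  rw [restrict_pull, restrict_pr4_val]

/-- (Ported verbatim from the HodgeCMPerL package; no docstring in the source.) -/
theorem restrict_pullC_pr4 (K : CMField) (Φ : Fin 4 → CMType K) (i : Fin 4) (k : ℕ) :
    (U.restrict C).pullC ((U.restrict C).pr4 K Φ i) k = U.pullC (U.pr4 K Φ i) k := by
  rw [restrict_pullC, restrict_pr4_val]

/-- (Ported verbatim from the HodgeCMPerL package; no docstring in the source.) -/
theorem restrict_weilGenerators (K : CMField) (Φ : Fin 4 → CMType K) :
    (U.restrict C).weilGenerators K Φ = U.weilGenerators K Φ := by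
  ext x
  simp only [weilGenerators, Set.mem_setOf_eq, restrict_pullC_pr4]
  rfl

/-- (Ported verbatim from the HodgeCMPerL package; no docstring in the source.) -/
theorem restrict_weilLine (K : CMField) (Φ : Fin 4 → CMType K) :
    (U.restrict C).weilLine K Φ = U.weilLine K Φ := by
  rw [weilLine, weilLine, restrict_weilGenerators]

/-- A diagonal action in the restricted universe is one in `U`. -/
theorem restrict_isDiagAct {K : CMField} {Φ : Fin 4 → CMType K} {a : K}
    {M : (U.restrict C).Mor ((U.restrict C).prod4 K Φ) ((U.restrict C).prod4 K Φ)}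
    (h : (U.restrict C).IsDiagAct K Φ a M) : U.IsDiagAct K Φ a M.1 := by
  obtain ⟨e, he, hM⟩ := h
  refine ⟨fun i => (e i).1, he, fun i k => ?_⟩
  have := hM i k
  rwa [restrict_pull_pr4] at this

/-- **Transfer of the model axioms** to the restricted universe, given the four existence axioms there. -/
theorem ModelAxioms.restrict (M : U.ModelAxioms) (hdom : (U.restrict C).Fact_cmDominated)
    (hlift : (U.restrict C).Fact_lift) (hend : (U.restrict C).Fact_cmEnd)
    (hconj : (U.restrict C).Fact_conjIsogeny) : (U.restrict C).ModelAxioms where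
  pull_id := fun X k => M.pull_id X k
  pull_comp := fun X Y Z f g k => M.pull_comp X Y Z f.1 g.1 k
  pull_cup := fun X Y f i j x y => M.pull_cup X Y f.1 i j x y
  pull_hodge := fun X Y f k p => M.pull_hodge X Y f.1 k p
  cup2_hodge := M.cup2_hodge
  tr_degree := M.tr_degree
  alg_le_hodge := M.alg_le_hodge
  pull_alg := fun X Y f p => M.pull_alg X Y f.1 p
  cup_alg := M.cup_alg
  lefschetz11 := M.lefschetz11
  cmAV := M.cmAV
  eigenLine := M.eigenLine
  alphaLine := M.alphaLine
  cmDominated := hdom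
  weilLine_rank := fun K Φ => by
    rw [restrict_weilLine]
    exact M.weilLine_rank K Φ
  weilLine_hodge := fun K f => by
    rw [restrict_weilLine]
    exact M.weilLine_hodge K f
  pms_dim := M.pms_dim
  lift := hlift
  cup_comm1 := M.cup_comm1
  cup_interchange := M.cup_interchange
  kunneth1 := fun X Y => M.kunneth1 X Y
  H1_rank := M.H1_rank
  H4_span := M.H4_span
  cmEnd := hend
  conjIsogeny := hconj
  gysin_surface := fun S X f h => M.gysin_surface S X f.1 h
  deg_diag := fun K Φ a N hN k => M.deg_diag K Φ a N.1 (restrict_isDiagAct C hN) k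
  algDuality := fun K Φ => by
    obtain ⟨D, hD, halg, hint⟩ := M.algDuality K Φ
    exact ⟨D, hD, halg, fun a Na Nb ha hb => hint a Na.1 Nb.1 (restrict_isDiagAct C ha) (restrict_isDiagAct C hb)⟩

end Universe

end HodgeCM

end
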